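import Summits.ValiantsHypothesis.ValiantsHypothesis.Theses.LangWeilTransfer

/-!
# Birth skeleton — crux `TameTransfer` (item `stmt-ValiantsHypothesis-6373`), line `birth`

Route `route-ValiantsHypothesis-LangWeilTransfer`, crux
`Summit.ValiantsHypothesis.ValiantsHypothesis.Theses.LangWeilTransfer.TameTransfer` (THEOREM T, the
GRH-free arithmetic core: an integer system `S` of degree `≤ d`, weight `≤ w` in `m` unknowns whose
`ℚ`-ideal has a minimal prime with `≤ B` geometric components has a solution over `GaloisField p r`
with `2^T < p` and `p^r ≤ 2^((B+T+m+log d+log log w+log t+2)^a)`).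

The cut follows the route's own proof plan (header: TameResolution → GoodReduction → LangWeilBound →
clear denominators, support `TransferGlue`), regrouped into THREE stubs with disjoint content and a
sorry-free composition, all sizes measured by ONE parameter `n ≥ 2` (`m < n`, `t, d ≤ 2^n`,
`w ≤ 2^(2^n)`; in the composition `n := B + m + log₂ d + log₂ log₂ w + log₂ t + 2`, so the crux's
envelope base is literally `n + T`):

* `stub_tameModel` (TameResolution + Nullstellensatz/Gauss clearing of denominators; XL) — a TAME
  HYPERSURFACE MODEL of the tame component: `Q ∈ ℤ[X_1..X_k]` irreducible over `ℚ` with at most `B`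
  geometric factors, an avoidance polynomial `G` with `Q ∤ G` over `ℚ` (it carries the denominator
  `ρ` of the Kronecker parametrisation), `k ≤ n`, degrees `≤ 2^(n^a)`, weights `≤ 2^(2^(n^a))`, a set
  of `≤ 2^(n^a)` exceptional primes, and the TRANSFER: modulo every other prime, every
  `GaloisField p r`-point of `Q = 0, G ≠ 0` yields a `GaloisField p r`-solution of `S` (the integer
  identities `ρ^D · S_i(V/ρ) ∈ (Q)` specialise to any field).  `T`-free.
* `stub_goodPrimePoints` (GoodReduction + effective Lang–Weil with avoidance + resultant bookkeeping;
  L) — for such a pair `(Q, G)` of size `n` and `≤ f ≤ n` geometric factors, outside `≤ 2^(n^a)` bad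
  primes EVERY prime `p` has an extension degree `0 < r ≤ n^a` (`r = f'·μ`: residue degree `f' ≤ f`
  of a prime of the field of definition of an absolutely irreducible factor, times the Lang–Weil
  threshold exponent `μ = O(n)`) and a point of `Q = 0, G ≠ 0` over `GaloisField p r`.  `T`-free.
* `stub_primeSupply` (Chebyshev; M, provable now from `Mathlib.NumberTheory.Chebyshev`) — more than
  `2^L` primes in `(2^T, 2^(c(T+L+1))]`.
* `TameTransfer_of` — the composition, kernel-checked and sorry-free: instantiate the model at `n`,
  the points at `n' = n^(a₁+1)`, take `L` with `2^L ≥ #bad₁ + #bad₂`, pick by pigeonhole a supplied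
  prime outside both bad sets, transfer the point, and certify the envelope
  `c·(T+L+1)·r ≤ (n+T)^(c+2e+2)`, `e = (a₁+1)(a₂+1)` (`envelope_bound`).

Disproof used: none exists for this crux at registration (`ledger crux ls stmt-ValiantsHypothesis-6373`:
no workfiles; no `_false_without_` theorem; negatives index has nothing on reduction modulo primes).
Refuter audit g41-12 (item notes) is honoured: the `log₂ log₂ w` term is kept (it enters `n`), and
the `m = 0` / zero-dimensional regimes are inside the stubs' hypotheses (vacuity guards: `2 ≤ n`
excludes the `n = 1` artefact where `2^(n^a) = 2` would be a false bound for `stub_goodPrimePoints`: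
`Q = X + 3`, `G = 3X² − X`, `G(−3) = 30` forces the three bad primes `2, 3, 5`).

BC3 record (registrar session planner-skel-stmt-ValiantsHypothesis-6373-0, 2026-08-17): `lean check`
rc 0, sorries = 3 = stubs (zero elsewhere; `TameTransfer_of` axioms `propext`, `Classical.choice`,
`Quot.sound`; `#h21_check_skeleton` preview ok, theorem `TameTransfer_of`, codes []); probes
`stub → TameTransfer` and `stub → ValiantsHypothesis` by `first | exact? | simpa | aesop` at
`maxHeartbeats 400000`: 6/6 FAIL (unsolved goals after exhaustive aesop search); variants
`simpa [defs]` and `unfold; aesop`: 12/12 FAIL (whnf/simp heartbeat timeouts, `assumption` failures,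
exhaustive-search failures); converses `TameTransfer → stub`, `ValiantsHypothesis → stub`: 6/6 fail
(info). No stub is cheaply the crux or the summit.
-/

set_option linter.dupNamespace false

namespace Summit.ValiantsHypothesis.ValiantsHypothesis.Cruxes.TameTransfer.Birth

open Summit.ValiantsHypothesis.ValiantsHypothesis.Theses.LangWeilTransfer
open Literature.Computability.AlgebraicComplexity

/-- **TameModel — TAME HYPERSURFACE MODEL WITH TRANSFER TO FINITE FIELDS** (stub statement, named).
For a size parameter `n ≥ 2` and an integer system `S` (`t ≤ 2^n` polynomials in `m < n` unknowns,
degrees `≤ 2^n`, weights `≤ 2^(2^n)`) whose `ℚ`-ideal has a minimal prime `𝔭` with `0 < g ≤ B`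
geometric components: there are `k ≤ n`, `Q, G ∈ ℤ[X_1..X_k]` with `Q` irreducible over `ℚ` having
`0 < · ≤ B` geometric factors and `Q ∤ G` over `ℚ`, of degrees `≤ 2^(n^a)` and weights
`≤ 2^(2^(n^a))`, and a set of `≤ 2^(n^a)` exceptional primes, such that for every other prime `p`,
every `r` and every `x ∈ GaloisField p r ^ k` with `Q(x) = 0 ≠ G(x)` there is a solution of `S` over
`GaloisField p r`. [Kronecker/Krick–Pardo–Sombra parametrisation of `V(𝔭)` after an integer linear
change (Noether position + primitive element: `Q` = minimal polynomial of the primitive element over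
`ℚ(T_1..T_r)`, `k = r+1 ≤ m+1`, `G = ρ`), geometric factors of `Q` ↔ images of the geometric
components of `V(𝔭)`, and `Q ∣ ρ^{deg S_i} S_i(V/ρ)` in `ℤ[T,U]` by the Nullstellensatz and Gauss's
lemma, which specialises modulo every prime; KrickPardo1996, doi:10.1215/s0012-7094-01-10934-4
(KPS 2001 Cor 2.11, Lemma 4.1, Prop 4.5), Burgisser2000TCS Thm 4.5 (zero-dimensional case, in tree:
BurgisserThm45Proofs), route support `TameResolution`] -/
def TameModel : Prop :=
  ∃ a : ℕ, ∀ (n m t B : ℕ) (S : Fin t → MvPolynomial (Fin m) ℤ),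
    2 ≤ n → m < n → t ≤ 2 ^ n →
    (∀ i, (S i).totalDegree ≤ 2 ^ n) →
    (∀ i, weight (S i) ≤ 2 ^ 2 ^ n) →
    (∃ 𝔭 ∈ (Ideal.span (Set.range fun i => MvPolynomial.map (Int.castRingHom ℚ) (S i))).minimalPrimes,
      0 < ((Ideal.map (MvPolynomial.map (algebraMap ℚ (AlgebraicClosure ℚ))) 𝔭).minimalPrimes).ncard ∧
      ((Ideal.map (MvPolynomial.map (algebraMap ℚ (AlgebraicClosure ℚ))) 𝔭).minimalPrimes).ncard ≤ B) →
    ∃ (k : ℕ) (Q G : MvPolynomial (Fin k) ℤ) (bad : Finset ℕ),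
      k ≤ n ∧
      Irreducible (MvPolynomial.map (Int.castRingHom ℚ) Q) ∧
      0 < ((Ideal.map (MvPolynomial.map (algebraMap ℚ (AlgebraicClosure ℚ)))
        (Ideal.span {MvPolynomial.map (Int.castRingHom ℚ) Q})).minimalPrimes).ncard ∧
      ((Ideal.map (MvPolynomial.map (algebraMap ℚ (AlgebraicClosure ℚ)))
        (Ideal.span {MvPolynomial.map (Int.castRingHom ℚ) Q})).minimalPrimes).ncard ≤ B ∧
      ¬ (MvPolynomial.map (Int.castRingHom ℚ) Q ∣ MvPolynomial.map (Int.castRingHom ℚ) G) ∧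
      Q.totalDegree ≤ 2 ^ n ^ a ∧ G.totalDegree ≤ 2 ^ n ^ a ∧
      weight Q ≤ 2 ^ 2 ^ n ^ a ∧ weight G ≤ 2 ^ 2 ^ n ^ a ∧
      bad.card ≤ 2 ^ n ^ a ∧
      ∀ (p : ℕ) [Fact p.Prime], p ∉ bad → ∀ (r : ℕ) (x : Fin k → GaloisField p r),
        MvPolynomial.aeval x Q = 0 → MvPolynomial.aeval x G ≠ 0 →
        ∃ z : Fin m → GaloisField p r, ∀ i, MvPolynomial.aeval z (S i) = 0

/-- **GoodPrimePoints — POINTS ON THE MODEL MODULO EVERY GOOD PRIME, IN SMALL DEGREE** (stub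
statement, named). For `n ≥ 2`, `k ≤ n`, `f ≤ n` and `Q, G ∈ ℤ[X_1..X_k]` of degrees `≤ 2^n` and
weights `≤ 2^(2^n)` with `Q` irreducible over `ℚ` having `0 < · ≤ f` geometric factors and `Q ∤ G`
over `ℚ`: outside a set of `≤ 2^(n^a)` bad primes, every prime `p` admits `0 < r ≤ n^a` and a point
`x ∈ GaloisField p r ^ k` with `Q(x) = 0 ≠ G(x)`. [good reduction of an absolutely irreducible factor
`Q₁` of `Q` defined over a number field of degree `≤ f` (residue degree `f' ≤ f`; bad primes from
Noether/Ruppert irreducibility forms: doi:10.1006/jcss.1995.1023 Kaltofen 1995 Thm 7/8 — vendored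
`kaltofen1995_thm7/_thm8` —, doi:10.1515/crll.1986.369.167, doi:10.1007/s000130050041; Schmidt
LNM 536 Cor V.2B), `Q₁ ∤ G mod p` off the primes dividing a resultant, and effective Lang–Weil with
avoidance over `GaloisField p (f'μ)`, `p^(f'μ) > a(δ+1)^a(deg G+1)^a` (doi:10.2307/2372655;
doi:10.1016/j.ffa.2005.03.003 Cafure–Matera Thm 5.2/5.4, in tree `CafureMatera2006_thm52`); route
supports `GoodReduction`, `LangWeilBound`] -/
def GoodPrimePoints : Prop :=
  ∃ a : ℕ, ∀ (n k f : ℕ) (Q G : MvPolynomial (Fin k) ℤ),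
    2 ≤ n → k ≤ n → f ≤ n →
    Irreducible (MvPolynomial.map (Int.castRingHom ℚ) Q) →
    0 < ((Ideal.map (MvPolynomial.map (algebraMap ℚ (AlgebraicClosure ℚ)))
      (Ideal.span {MvPolynomial.map (Int.castRingHom ℚ) Q})).minimalPrimes).ncard →
    ((Ideal.map (MvPolynomial.map (algebraMap ℚ (AlgebraicClosure ℚ)))
      (Ideal.span {MvPolynomial.map (Int.castRingHom ℚ) Q})).minimalPrimes).ncard ≤ f →
    ¬ (MvPolynomial.map (Int.castRingHom ℚ) Q ∣ MvPolynomial.map (Int.castRingHom ℚ) G) →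
    Q.totalDegree ≤ 2 ^ n → G.totalDegree ≤ 2 ^ n →
    weight Q ≤ 2 ^ 2 ^ n → weight G ≤ 2 ^ 2 ^ n →
    ∃ bad : Finset ℕ, bad.card ≤ 2 ^ n ^ a ∧
      ∀ (p : ℕ) [Fact p.Prime], p ∉ bad →
        ∃ r : ℕ, 0 < r ∧ r ≤ n ^ a ∧
          ∃ x : Fin k → GaloisField p r, MvPolynomial.aeval x Q = 0 ∧ MvPolynomial.aeval x G ≠ 0

/-- **PrimeSupply — CHEBYSHEV SUPPLY OF PRIMES BEYOND `2^T`** (stub statement, named): for some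
absolute `c`, every interval `(2^T, 2^(c(T+L+1))]` contains more than `2^L` primes. [Chebyshev's
lower bound `π(x) ≫ x / log x`: Mathlib `Chebyshev.psi_ge`, `Chebyshev.psi_le_primeCounting_mul_log`;
`c = 4` suffices; folklore / HardyWright Thm 414] -/
def PrimeSupply : Prop :=
  ∃ c : ℕ, ∀ (T L : ℕ), ∃ P : Finset ℕ, 2 ^ L < P.card ∧
    ∀ p ∈ P, p.Prime ∧ 2 ^ T < p ∧ p ≤ 2 ^ (c * (T + L + 1))

/-- Stub TameModel (registered obligation; signature = `TameModel` verbatim). [KrickPardo1996,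
doi:10.1215/s0012-7094-01-10934-4, Burgisser2000TCS Thm 4.5] -/
theorem stub_tameModel :
    ∃ a : ℕ, ∀ (n m t B : ℕ) (S : Fin t → MvPolynomial (Fin m) ℤ),
      2 ≤ n → m < n → t ≤ 2 ^ n →
      (∀ i, (S i).totalDegree ≤ 2 ^ n) →
      (∀ i, weight (S i) ≤ 2 ^ 2 ^ n) →
      (∃ 𝔭 ∈ (Ideal.span (Set.range fun i => MvPolynomial.map (Int.castRingHom ℚ) (S i))).minimalPrimes,
        0 < ((Ideal.map (MvPolynomial.map (algebraMap ℚ (AlgebraicClosure ℚ))) 𝔭).minimalPrimes).ncard ∧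
        ((Ideal.map (MvPolynomial.map (algebraMap ℚ (AlgebraicClosure ℚ))) 𝔭).minimalPrimes).ncard ≤ B) →
      ∃ (k : ℕ) (Q G : MvPolynomial (Fin k) ℤ) (bad : Finset ℕ),
        k ≤ n ∧
        Irreducible (MvPolynomial.map (Int.castRingHom ℚ) Q) ∧
        0 < ((Ideal.map (MvPolynomial.map (algebraMap ℚ (AlgebraicClosure ℚ)))
          (Ideal.span {MvPolynomial.map (Int.castRingHom ℚ) Q})).minimalPrimes).ncard ∧
        ((Ideal.map (MvPolynomial.map (algebraMap ℚ (AlgebraicClosure ℚ)))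
          (Ideal.span {MvPolynomial.map (Int.castRingHom ℚ) Q})).minimalPrimes).ncard ≤ B ∧
        ¬ (MvPolynomial.map (Int.castRingHom ℚ) Q ∣ MvPolynomial.map (Int.castRingHom ℚ) G) ∧
        Q.totalDegree ≤ 2 ^ n ^ a ∧ G.totalDegree ≤ 2 ^ n ^ a ∧
        weight Q ≤ 2 ^ 2 ^ n ^ a ∧ weight G ≤ 2 ^ 2 ^ n ^ a ∧
        bad.card ≤ 2 ^ n ^ a ∧
        ∀ (p : ℕ) [Fact p.Prime], p ∉ bad → ∀ (r : ℕ) (x : Fin k → GaloisField p r),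
          MvPolynomial.aeval x Q = 0 → MvPolynomial.aeval x G ≠ 0 →
          ∃ z : Fin m → GaloisField p r, ∀ i, MvPolynomial.aeval z (S i) = 0 := by
  sorry

/-- Stub GoodPrimePoints (registered obligation; signature = `GoodPrimePoints` verbatim).
[doi:10.1006/jcss.1995.1023, doi:10.1515/crll.1986.369.167, doi:10.2307/2372655,
doi:10.1016/j.ffa.2005.03.003] -/
theorem stub_goodPrimePoints :
    ∃ a : ℕ, ∀ (n k f : ℕ) (Q G : MvPolynomial (Fin k) ℤ),
      2 ≤ n → k ≤ n → f ≤ n →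
      Irreducible (MvPolynomial.map (Int.castRingHom ℚ) Q) →
      0 < ((Ideal.map (MvPolynomial.map (algebraMap ℚ (AlgebraicClosure ℚ)))
        (Ideal.span {MvPolynomial.map (Int.castRingHom ℚ) Q})).minimalPrimes).ncard →
      ((Ideal.map (MvPolynomial.map (algebraMap ℚ (AlgebraicClosure ℚ)))
        (Ideal.span {MvPolynomial.map (Int.castRingHom ℚ) Q})).minimalPrimes).ncard ≤ f →
      ¬ (MvPolynomial.map (Int.castRingHom ℚ) Q ∣ MvPolynomial.map (Int.castRingHom ℚ) G) →
      Q.totalDegree ≤ 2 ^ n → G.totalDegree ≤ 2 ^ n →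
      weight Q ≤ 2 ^ 2 ^ n → weight G ≤ 2 ^ 2 ^ n →
      ∃ bad : Finset ℕ, bad.card ≤ 2 ^ n ^ a ∧
        ∀ (p : ℕ) [Fact p.Prime], p ∉ bad →
          ∃ r : ℕ, 0 < r ∧ r ≤ n ^ a ∧
            ∃ x : Fin k → GaloisField p r,
              MvPolynomial.aeval x Q = 0 ∧ MvPolynomial.aeval x G ≠ 0 := by
  sorry

/-- Stub PrimeSupply (registered obligation; signature = `PrimeSupply` verbatim). [Chebyshev;
Mathlib `Chebyshev.psi_ge`] -/
theorem stub_primeSupply :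
    ∃ c : ℕ, ∀ (T L : ℕ), ∃ P : Finset ℕ, 2 ^ L < P.card ∧
      ∀ p ∈ P, p.Prime ∧ 2 ^ T < p ∧ p ≤ 2 ^ (c * (T + L + 1)) := by
  sorry

/-! ## Name-keyed aliases of the stub statements (hypotheses of the composition)

`Registered.stub_X` is the statement of `stub_X` under the registered stub's short name, so that the
native skeleton audit (`#h21_check_skeleton`: hypotheses admissible iff registered obligations /
declared stubs BY NAME) accepts `TameTransfer_of : Registered.stub_… → … → TameTransfer`
(device of `Cruxes/RestorationQP/Lines/birth.lean`, `Cruxes/ClassTransfer/Lines/birth.lean`). -/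
namespace Registered

/-- Alias of `TameModel` (= the signature of `stub_tameModel`). -/
abbrev stub_tameModel : Prop := TameModel
/-- Alias of `GoodPrimePoints` (= the signature of `stub_goodPrimePoints`). -/
abbrev stub_goodPrimePoints : Prop := GoodPrimePoints
/-- Alias of `PrimeSupply` (= the signature of `stub_primeSupply`). -/
abbrev stub_primeSupply : Prop := PrimeSupply

end Registered

/-- Envelope bookkeeping of the composition: for `n ≥ 2`, `e ≥ 1`,
`c · (T + n^e + 2) · n^e ≤ (n + T)^(c + 2e + 2)`. [folklore] -/
theorem envelope_bound (c e n T : ℕ) (hn : 2 ≤ n) (he : 0 < e) :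
    c * (T + n ^ e + 2) * n ^ e ≤ (n + T) ^ (c + 2 * e + 2) := by
  obtain ⟨N, hN⟩ : ∃ N, N = n + T := ⟨_, rfl⟩
  rw [← hN]
  have hN2 : 2 ≤ N := by omega
  have h1 : n ^ e ≤ N ^ e := Nat.pow_le_pow_left (by omega) e
  have h2 : N ≤ N ^ e := by
    calc N = N ^ 1 := (pow_one N).symm
      _ ≤ N ^ e := Nat.pow_le_pow_right (by omega) he
  have h3 : T + n ^ e + 2 ≤ 3 * N ^ e := by omega
  have h4 : c ≤ N ^ c := (c.lt_two_pow_self).le.trans (Nat.pow_le_pow_left hN2 c)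
  have h5 : 3 ≤ N ^ 2 := by
    calc 3 ≤ 2 * 2 := by norm_num
      _ ≤ N * N := Nat.mul_le_mul hN2 hN2
      _ = N ^ 2 := (pow_two N).symm
  calc c * (T + n ^ e + 2) * n ^ e ≤ N ^ c * (3 * N ^ e) * N ^ e :=
        Nat.mul_le_mul (Nat.mul_le_mul h4 h3) h1
    _ = 3 * N ^ (c + 2 * e) := by ring
    _ ≤ N ^ 2 * N ^ (c + 2 * e) := Nat.mul_le_mul_right _ h5
    _ = N ^ (c + 2 * e + 2) := by ring

/-- **Composition** (the glue of the line, kernel-checked): tame model at the size parameter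
`n = B + m + log₂ d + log₂ log₂ w + log₂ t + 2`, points modulo good primes at `n' = n^(a₁+1)`, a
Chebyshev prime beyond `2^T` outside the `≤ 2·2^E` bad primes (`E = n'^(a₂+1)`) by pigeonhole,
transfer of the point, and the envelope `p^r ≤ 2^(c(T+E+2)·E) ≤ 2^((n+T)^(c+2e+2))`. [folklore] -/
theorem TameTransfer_of :
    Registered.stub_tameModel → Registered.stub_goodPrimePoints → Registered.stub_primeSupply →
      TameTransfer := by
  intro h₁ h₂ h₃
  obtain ⟨a₁, hM⟩ := h₁
  obtain ⟨a₂, hP⟩ := h₂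
  obtain ⟨c, hC⟩ := h₃
  refine ⟨c + 2 * ((a₁ + 1) * (a₂ + 1)) + 2, ?_⟩
  intro m t d w B T S hd hw h𝔭
  -- the size parameter
  obtain ⟨n, hn⟩ : ∃ n : ℕ, n = B + m + Nat.log 2 d + Nat.log 2 (Nat.log 2 w) + Nat.log 2 t + 2 :=
    ⟨_, rfl⟩
  have hn2 : 2 ≤ n := by omega
  have hn1 : 1 ≤ n := by omega
  have hmn : m < n := by omega
  have hBn : B ≤ n := by omega
  have ht : t ≤ 2 ^ n := by
    have h1 := Nat.lt_pow_succ_log_self Nat.one_lt_two t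
    have h2 : 2 ^ (Nat.log 2 t).succ ≤ 2 ^ n := Nat.pow_le_pow_right (by norm_num) (by omega)
    omega
  have hdn : d ≤ 2 ^ n := by
    have h1 := Nat.lt_pow_succ_log_self Nat.one_lt_two d
    have h2 : 2 ^ (Nat.log 2 d).succ ≤ 2 ^ n := Nat.pow_le_pow_right (by norm_num) (by omega)
    omega
  have hwn : w ≤ 2 ^ 2 ^ n := by
    have h1 := Nat.lt_pow_succ_log_self Nat.one_lt_two w
    have h2 := Nat.lt_pow_succ_log_self Nat.one_lt_two (Nat.log 2 w)
    have h3 : 2 ^ (Nat.log 2 (Nat.log 2 w)).succ ≤ 2 ^ n :=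
      Nat.pow_le_pow_right (by norm_num) (by omega)
    have h4 : 2 ^ (Nat.log 2 w).succ ≤ 2 ^ 2 ^ n := Nat.pow_le_pow_right (by norm_num) (by omega)
    omega
  have hdeg : ∀ i, (S i).totalDegree ≤ 2 ^ n := fun i => (hd i).trans hdn
  have hwt : ∀ i, weight (S i) ≤ 2 ^ 2 ^ n := fun i => (hw i).trans hwn
  -- Stage 1: the tame hypersurface model
  obtain ⟨k, Q, G, bad₁, hk, hQirr, hg0, hgB, hndvd, hdQ, hdG, hwQ, hwG, hbad₁, htransfer⟩ :=
    hM n m t B S hn2 hmn ht hdeg hwt h𝔭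
  -- Stage 2: points modulo good primes, at the parameter n' = n ^ (a₁ + 1)
  obtain ⟨n', hn'⟩ : ∃ n' : ℕ, n' = n ^ (a₁ + 1) := ⟨_, rfl⟩
  have hnn' : n ≤ n' := by
    rw [hn']
    calc n = n ^ 1 := (pow_one n).symm
      _ ≤ n ^ (a₁ + 1) := Nat.pow_le_pow_right hn1 (by omega)
  have hn'2 : 2 ≤ n' := hn2.trans hnn'
  have hn'1 : 1 ≤ n' := by omega
  have hpow₁ : n ^ a₁ ≤ n' := by
    rw [hn']
    exact Nat.pow_le_pow_right hn1 (Nat.le_succ a₁)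
  have hdQ' : Q.totalDegree ≤ 2 ^ n' := hdQ.trans (Nat.pow_le_pow_right (by norm_num) hpow₁)
  have hdG' : G.totalDegree ≤ 2 ^ n' := hdG.trans (Nat.pow_le_pow_right (by norm_num) hpow₁)
  have hwQ' : weight Q ≤ 2 ^ 2 ^ n' :=
    hwQ.trans (Nat.pow_le_pow_right (by norm_num) (Nat.pow_le_pow_right (by norm_num) hpow₁))
  have hwG' : weight G ≤ 2 ^ 2 ^ n' :=
    hwG.trans (Nat.pow_le_pow_right (by norm_num) (Nat.pow_le_pow_right (by norm_num) hpow₁))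
  obtain ⟨bad₂, hbad₂, hpts⟩ :=
    hP n' k B Q G hn'2 (hk.trans hnn') (hBn.trans hnn') hQirr hg0 hgB hndvd hdQ' hdG' hwQ' hwG'
  -- Stage 3: a prime beyond 2 ^ T outside both bad sets (pigeonhole against the Chebyshev supply)
  obtain ⟨E, hE'⟩ : ∃ E : ℕ, E = n' ^ (a₂ + 1) := ⟨_, rfl⟩
  have hE : E = n ^ ((a₁ + 1) * (a₂ + 1)) := by rw [hE', hn', ← pow_mul]
  have hn'E : n' ≤ E := by
    rw [hE']
    calc n' = n' ^ 1 := (pow_one n').symm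
      _ ≤ n' ^ (a₂ + 1) := Nat.pow_le_pow_right hn'1 (by omega)
  have hpow₂ : n' ^ a₂ ≤ E := by
    rw [hE']
    exact Nat.pow_le_pow_right hn'1 (Nat.le_succ a₂)
  have hcard : (bad₁ ∪ bad₂).card ≤ 2 ^ (E + 1) := by
    have h1 : bad₁.card ≤ 2 ^ E :=
      hbad₁.trans (Nat.pow_le_pow_right (by norm_num) (hpow₁.trans hn'E))
    have h2 : bad₂.card ≤ 2 ^ E := hbad₂.trans (Nat.pow_le_pow_right (by norm_num) hpow₂)
    calc (bad₁ ∪ bad₂).card ≤ bad₁.card + bad₂.card := Finset.card_union_le _ _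
      _ ≤ 2 ^ E + 2 ^ E := Nat.add_le_add h1 h2
      _ = 2 ^ (E + 1) := by rw [pow_succ]; ring
  obtain ⟨P, hPcard, hPmem⟩ := hC T (E + 1)
  obtain ⟨p, hpP, hpbad⟩ := Finset.exists_mem_notMem_of_card_lt_card (hcard.trans_lt hPcard)
  obtain ⟨hp, hTp, hple⟩ := hPmem p hpP
  have hp₁ : p ∉ bad₁ := fun h => hpbad (Finset.mem_union_left _ h)
  have hp₂ : p ∉ bad₂ := fun h => hpbad (Finset.mem_union_right _ h)
  haveI : Fact p.Prime := ⟨hp⟩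
  obtain ⟨r, hr0, hrle, x, hxQ, hxG⟩ := hpts p hp₂
  obtain ⟨z, hz⟩ := htransfer p hp₁ r x hxQ hxG
  refine ⟨p, r, ‹Fact p.Prime›, hTp, hr0, ?_, z, hz⟩
  -- Stage 4: the envelope
  have hrE : r ≤ E := hrle.trans hpow₂
  have key : c * (T + (E + 1) + 1) * r ≤ (n + T) ^ (c + 2 * ((a₁ + 1) * (a₂ + 1)) + 2) := by
    have h1 : c * (T + (E + 1) + 1) * r ≤ c * (T + E + 2) * E := by
      have h0 : T + (E + 1) + 1 = T + E + 2 := by omega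
      rw [h0]
      exact Nat.mul_le_mul_left _ hrE
    have h2 : c * (T + E + 2) * E ≤ (n + T) ^ (c + 2 * ((a₁ + 1) * (a₂ + 1)) + 2) := by
      rw [hE]
      exact envelope_bound c ((a₁ + 1) * (a₂ + 1)) n T hn2
        (Nat.mul_pos (Nat.succ_pos a₁) (Nat.succ_pos a₂))
    exact h1.trans h2
  have hX : n + T = B + T + m + Nat.log 2 d + Nat.log 2 (Nat.log 2 w) + Nat.log 2 t + 2 := by omega
  calc p ^ r ≤ (2 ^ (c * (T + (E + 1) + 1))) ^ r := Nat.pow_le_pow_left hple r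
    _ = 2 ^ (c * (T + (E + 1) + 1) * r) := (pow_mul 2 _ r).symm
    _ ≤ 2 ^ ((n + T) ^ (c + 2 * ((a₁ + 1) * (a₂ + 1)) + 2)) := Nat.pow_le_pow_right (by norm_num) key
    _ = 2 ^ ((B + T + m + Nat.log 2 d + Nat.log 2 (Nat.log 2 w) + Nat.log 2 t + 2) ^
          (c + 2 * ((a₁ + 1) * (a₂ + 1)) + 2)) := by rw [hX]

/-- Wiring check: the registered stubs feed `TameTransfer_of` exactly as stated, so the skeleton is
`TameTransfer` closed modulo the three stubs (sorries enter only through them). -/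
example : TameTransfer :=
  TameTransfer_of stub_tameModel stub_goodPrimePoints stub_primeSupply

end Summit.ValiantsHypothesis.ValiantsHypothesis.Cruxes.TameTransfer.Birth
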